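import Mathlib
import Summits.MatrixMultiplication.Statement
import Summits.MatrixMultiplication.MatrixMultiplication.Theorems.GraphEquationsInitialForms

/-!
# Pure systems are read exactly at a point off the graph (`GraphEquations`, kernel M27)

Decomp-mm node «GraphEquations» (lens 5, g36); attacked leaf `MultiplicityReduction`
(stmt-MatrixMultiplication-27806).  Target of the node, VERBATIM: `_root_.MatrixMultiplication`.
Route-neutral (`closes` unchanged); imports no `Theses/` file.

**The point.**  Kernel M8 (`GraphEquationsInitialForms.tensorRank_le_of_initialForms`) reads a
cheap family whose weighted initial forms of orders `m_o ≤ K` are PURE (`P_o(f)`, `P_o ∈ ℂ[F]`)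
with a gradient matrix of rank `n²` at some `γ`, at exact rank `≤ 2·K²·N` — the factor `K²` being
the price of the weighted truncation.  For a family that is GLOBALLY pure — every test is a
constant-coefficient polynomial `P_o(f)` in the generators `f_q = c_q - Σ_k a_{q₁k} b_{kq₂}`, of ANY
degrees — no truncation is needed: substituting `c ↦ γ` (cost-free) gives `P_o(γ - ab)`, whose
`a ⊗ b`-block is EXACTLY `-Σ_q (∂P_o/∂F_q)(γ)·(ab)_q` (`coeff_ab_aeval_psi`, M8), and a left
inverse of the gradient matrix serves `⟨n,n,n⟩`:

* `tensorRank_le_of_pureTests` — globally pure family, gradient rank `n²` at some `γ` ⟹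
  `R(⟨n,n,n⟩) ≤ 2N`, with NO dependence on the degrees / the multiplicity of the fat point;
* `EqSystem.tensorRank_le_of_pure` — the equation-system form (`R ≤ 2·cost`).

**Consequence for the census (NODE-g36 §4).**  Every pure fat point of the lineage's probes — pure
powers `f_q^k`, the cusp `(f_x² - f_y³, f_x⁴, f_y⁴)`, the Puiseux cascades, the entangled blocks
`(f_x + 5f_y + f_y², f_y³)`, `𝔪^k` — is read EXACTLY at rank `2N` by expanding at a point `c = γ`
OFF the graph where the polynomial map `P` is étale (for an `(F)`-primary pure family the gradient
matrix has rank `n²` at generic `γ`, M9a's `IsolatedForcesRank`), whereas every engine expanding at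
points OF the graph (deflation, the derivative tower `GraphEquationsTowerSupply`, arcs) pays
`3^{m-1}` or worse for the multiplicity `m`.  Multiplicity of a PURE system is therefore free even in
exact rank; the residual obstruction behind `MultiplicityReduction` is impurity of the initial forms
(tangential coefficients: MASKING), i.e. M9a's `Purification` — in border rank without its order
bound (`GraphEquationsBorderReadOut`).  No `sorry`.

Sources: [BurgisserClausenShokrollahi1997, §4.1 Rem. (4.3), Prop. (14.1), Problem 16.3];
[Strassen1973].
-/

set_option linter.dupNamespace false

noncomputable section

open scoped BigOperators

namespace Summit.MatrixMultiplication.MatrixMultiplication.Theorems.GraphEquations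

open MvPolynomial
open Literature.Computability.AlgebraicComplexity

variable {n : ℕ}

/-- **PURE FAMILIES ARE READ EXACTLY OFF THE GRAPH.**  Let `T` polynomials `P_o(f)` — constant-
coefficient polynomials in the generators, of arbitrary degrees — lie in the cost-free span of one
nonscalar sequence of length `≤ N`, and let the gradient matrix `(∂P_o/∂F_q)(γ)` have rank `n²` at
some `γ`.  Then `R(⟨n,n,n⟩) ≤ 2N`. -/
theorem tensorRank_le_of_pureTests {T N : ℕ} (P : Fin T → MvPolynomial (Fin n × Fin n) ℂ)
    (hspan : ∃ gs : List (MvPolynomial (GraphVars n) ℂ), IsNonscalarSeq gs ∧ gs.length ≤ N ∧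
      ∀ o, aeval (generator n) (P o) ∈ freeSpan {q | q ∈ gs})
    (γ : Fin n × Fin n → ℂ) (hrank : (gradMatrix γ P).rank = n * n) :
    tensorRank (matMulTensor ℂ n n n) ≤ 2 * N := by
  classical
  obtain ⟨gs, hns, hlen, hmem⟩ := hspan
  -- substitute `c ↦ γ` (free)
  obtain ⟨hns', hmem'⟩ :=
    IsNonscalarSeq.aeval_append (θ := constC γ) (hs := []) (constC_mem_freeSpan γ)
      isNonscalarSeq_nil hns
  -- BCS (14.1): the bilinear `A ⊗ B`-coefficients form a tensor of rank `≤ 2N`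
  obtain ⟨r, hr2, w, u, v, hwuv⟩ := exists_triads_of_isNonscalarSeq
    (fun a : Fin n × Fin n => (Sum.inl (Sum.inl a) : GraphVars n))
    (fun b : Fin n × Fin n => (Sum.inl (Sum.inr b) : GraphVars n))
    (fun a b hab => by simp at hab) (fun o => aeval (psi γ) (P o))
    ⟨gs.map (aeval (constC γ)) ++ [], hns', by simpa using hlen, fun o => by
      rw [← aeval_constC_aeval_generator]; exact hmem' _ (hmem o)⟩
  -- a left inverse of the gradient matrix recovers `⟨n,n,n⟩`
  obtain ⟨Pm, hPJ⟩ := leftInverse_of_rank_eq (gradMatrix γ P) hrank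
  refine le_trans (tensorRank_le_of_eq_sum (fun ρ c => -∑ o, Pm c o * w ρ o) u v ?_) hr2
  funext c a b
  obtain ⟨i, j⟩ := a
  obtain ⟨j', l⟩ := b
  have key : ∀ o, ∑ ρ, w ρ o * u ρ (i, j) * v ρ (j', l) =
      -(if j = j' then gradMatrix γ P o (i, l) else 0) := by
    intro o; rw [hwuv, coeff_ab_aeval_psi]; rfl
  have hPJ' : ∀ q, ∑ o, Pm c o * gradMatrix γ P o q = if c = q then 1 else 0 := by
    intro q
    have := congrFun (congrFun hPJ c) q
    simpa [Matrix.mul_apply, Matrix.one_apply] using this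
  have hsum : ∑ ρ, (-∑ o, Pm c o * w ρ o) * u ρ (i, j) * v ρ (j', l) =
      -∑ o, Pm c o * ∑ ρ, w ρ o * u ρ (i, j) * v ρ (j', l) := by
    simp only [neg_mul, Finset.sum_neg_distrib, Finset.sum_mul, Finset.mul_sum]
    rw [Finset.sum_comm]
    congr 1
    refine Finset.sum_congr rfl fun o _ => Finset.sum_congr rfl fun ρ _ => by ring
  simp only [Finset.sum_apply, triad_apply]
  rw [hsum]
  simp_rw [key]
  by_cases hjj : j = j'
  · subst hjj
    simp only [if_true, mul_neg, Finset.sum_neg_distrib, neg_neg, hPJ']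
    obtain ⟨c1, c2⟩ := c
    simp [matMulTensor, Prod.ext_iff]
  · simp [matMulTensor, hjj]

/-- **Pure powers, exactly.**  A family testing the pure powers `f_q^{k_q}` (`k_q ≥ 1`, arbitrary)
at cost `N` gives `R(⟨n,n,n⟩) ≤ 2N` in EXACT rank (gradient matrix `diag(k_q γ_q^{k_q-1})` at
`γ ≡ 1`) — compare the derivative tower's `2·3^{max k - 1}·N` (`GraphEquationsTowerSupply`). -/
theorem tensorRank_le_of_powersFree {N : ℕ} (k : Fin n × Fin n → ℕ) (hk : ∀ q, 1 ≤ k q)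
    (hfree : ∃ gs : List (MvPolynomial (GraphVars n) ℂ), IsNonscalarSeq gs ∧ gs.length ≤ N ∧
      ∀ q, generator n q ^ k q ∈ freeSpan {x | x ∈ gs}) :
    tensorRank (matMulTensor ℂ n n n) ≤ 2 * N := by
  classical
  -- index the family by `Fin (n*n)` through an equivalence
  set e := (Fintype.equivFin (Fin n × Fin n)).symm with he
  refine tensorRank_le_of_pureTests (T := Fintype.card (Fin n × Fin n))
    (fun o => X (e o) ^ k (e o)) ?_ (fun _ => 1) ?_
  · obtain ⟨gs, hns, hlen, hmem⟩ := hfree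
    exact ⟨gs, hns, hlen, fun o => by simpa [map_pow, aeval_X] using hmem (e o)⟩
  · -- the gradient matrix is `o ↦ k_{e o} • (row e o)`: a scaled permutation matrix
    have hG : gradMatrix (fun _ => (1 : ℂ)) (fun o => X (e o) ^ k (e o)) =
        Matrix.of fun o q => if e o = q then (k (e o) : ℂ) else 0 := by
      ext o q
      simp only [gradMatrix, Matrix.of_apply]
      rw [pderiv_pow, pderiv_X]
      by_cases h : e o = q
      · subst h
        simp [Pi.single_eq_same]
      · have h' : q ≠ e o := fun h'' => h h''.symm
        simp [h]
    rw [hG]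
    -- it is `(reindex) (diagonal k)`, of rank `n²` since all `k_q ≠ 0`
    have hM : (Matrix.of fun o q => if e o = q then (k (e o) : ℂ) else 0) =
        (Matrix.reindex e.symm (Equiv.refl _)
          (Matrix.diagonal fun q : Fin n × Fin n => (k q : ℂ))) := by
      ext o q
      simp only [Matrix.of_apply, Matrix.reindex_apply, Matrix.submatrix_apply, Equiv.refl_symm,
        Equiv.refl_apply, Equiv.symm_symm, Matrix.diagonal_apply]
    rw [hM, Matrix.rank_reindex, Matrix.rank_diagonal, Fintype.card_subtype_compl,
      Fintype.card_prod, Fintype.card_fin]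
    have h0 : Fintype.card {q : Fin n × Fin n // (k q : ℂ) = 0} = 0 := by
      rw [Fintype.card_eq_zero_iff]
      refine ⟨fun ⟨q, hq⟩ => ?_⟩
      have h1 := hk q
      have h2 : k q = 0 := by exact_mod_cast hq
      omega
    rw [h0, Nat.sub_zero]

namespace EqSystem

/-- **A PURE equation system is read exactly at cost `2·cost`.**  If every test of a fan-in-two
system is a constant-coefficient polynomial `P_o(f)` in the generators and the gradient matrix of
`P` has rank `n²` at some `γ`, then `R(⟨n,n,n⟩) ≤ 2·cost` — whatever the multiplicity. -/
theorem tensorRank_le_of_pure {E : EqSystem n} (hE : E.circuit.IsFanInTwo)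
    (P : Fin E.tests.length → MvPolynomial (Fin n × Fin n) ℂ)
    (hP : ∀ o, E.testPoly (E.tests.get o) = aeval (generator n) (P o))
    (γ : Fin n × Fin n → ℂ) (hrank : (gradMatrix γ P).rank = n * n) :
    tensorRank (matMulTensor ℂ n n n) ≤ 2 * E.cost := by
  obtain ⟨gs, hns, hlen, hmem⟩ := exists_isNonscalarSeq_tests E hE
  exact tensorRank_le_of_pureTests P ⟨gs, hns, hlen, fun o => by rw [← hP o]; exact hmem o⟩ γ hrank

end EqSystem

end Summit.MatrixMultiplication.MatrixMultiplication.Theorems.GraphEquations
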